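import Literature.Probability.FitznerVanDerHofstad2017.SawCountTables
import HarnessLib

/-!
# Geodesic self-avoiding walks: `c_n(x) = n! / ∏ᵢ |xᵢ|!` when `‖x‖₁ = n`

[folklore; used implicitly in Fitzner–van der Hofstad, *Mean-field behavior for nearest-neighbor
percolation in `d > 10`*, EJP 22 (2017), arXiv:1506.07977, notebook `SRW.nb` §3, where the classes
with `‖x‖₁ = n` carry the entries `nrSAW[n,d,x] = n!/∏ xᵢ!`, e.g. `nrSAW[10,d,{1,…,1}] = 10!`.]

When the number of steps equals the `ℓ¹`-distance of the end-point, every nearest-neighbour walk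
`0 → x` is a lattice geodesic (each step lowers the remaining distance by one), hence is
automatically self-avoiding, and the walks correspond to the arrangements of the multiset of
steps `{eᵢ^{|xᵢ|}}`: there are `n!/∏ᵢ |xᵢ|!` of them, for every `d`.

The proof runs on the end-point recursion `sawCount` of `SawCountRecursion` (peel off the last
step): a step away from the origin leaves an end-point out of reach (`sawCount_eq_zero_of_lt`),
the avoidance set never bites because every later site of a geodesic has larger norm than every
earlier one, and Pascal's rule for multinomial coefficients closes the induction.  This settles,
uniformly in `n`, the end-point classes that the kernel tables `SawCountTables*` reach only
length by length (and not at all for the three heaviest published ones, `x ∼ (1^6), (1^8), (1^10)`).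
-/

namespace Literature.Probability.FitznerVanDerHofstad2017

open Finset Literature.Probability.LatticeModels Literature.Probability.Percolation
open scoped Nat

variable {d : ℕ}

/-- The profile of absolute values `(|y_i|)_i` of a site. [folklore] -/
def absProfile (y : Site d) : Fin d → ℕ := fun i => (y i).natAbs

/-- `‖y‖₁ = Σ_i |y_i|`. [folklore] -/
theorem l1Norm_eq_sum_absProfile (y : Site d) : l1Norm y = ∑ i, absProfile y i := rfl

/-- **Pascal's rule for multinomial coefficients**:
`Σ_{i : fᵢ > 0} multinomial (f - δᵢ) = multinomial f` when `Σ f > 0`. [folklore] -/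
theorem sum_multinomial_update_pred (f : Fin d → ℕ) (hf : 0 < ∑ i, f i) :
    ∑ i ∈ univ.filter (fun i => 0 < f i), Nat.multinomial univ (Function.update f i (f i - 1))
      = Nat.multinomial univ f := by
  classical
  have key : ∀ i, 0 < f i →
      (∏ j, (f j)!) * Nat.multinomial univ (Function.update f i (f i - 1)) = f i * (∑ j, f j - 1)! := by
    intro i hi
    have hprod : (∏ j, (f j)!) = f i * ∏ j, ((Function.update f i (f i - 1)) j)! := by
      rw [← mul_prod_erase univ (fun j => (f j)!) (mem_univ i),
        ← mul_prod_erase univ (fun j => ((Function.update f i (f i - 1)) j)!) (mem_univ i)]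
      have hrest : ∏ j ∈ univ.erase i, ((Function.update f i (f i - 1)) j)! = ∏ j ∈ univ.erase i, (f j)! :=
        prod_congr rfl fun j hj => by rw [Function.update_of_ne (ne_of_mem_erase hj)]
      rw [hrest, Function.update_self, ← mul_assoc, Nat.mul_factorial_pred (Nat.pos_iff_ne_zero.1 hi)]
    have hsum : ∑ j, (Function.update f i (f i - 1)) j = ∑ j, f j - 1 := by
      rw [← add_sum_erase univ (fun j => (Function.update f i (f i - 1)) j) (mem_univ i)]
      have hrest : ∑ j ∈ univ.erase i, (Function.update f i (f i - 1)) j = ∑ j ∈ univ.erase i, f j :=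
        sum_congr rfl fun j hj => by rw [Function.update_of_ne (ne_of_mem_erase hj)]
      have htot := add_sum_erase univ f (mem_univ i)
      rw [hrest, Function.update_self]
      omega
    rw [hprod, mul_assoc, Nat.multinomial_spec, hsum]
  have hP : 0 < ∏ j, (f j)! := prod_pos fun j _ => Nat.factorial_pos _
  apply Nat.eq_of_mul_eq_mul_left hP
  rw [Nat.multinomial_spec, mul_sum, sum_congr rfl (fun i hi => key i (mem_filter.1 hi).2), ← sum_mul,
    sum_filter_of_ne (fun i _ hne => Nat.pos_of_ne_zero hne)]
  exact Nat.mul_factorial_pred (Nat.pos_iff_ne_zero.1 hf)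

/-- A step `a = (i, ±)` is *toward* `y` when its sign is the sign of `yᵢ ≠ 0`: read backwards from
`y`, the walk's last step then came from a site of smaller norm. [folklore] -/
def Toward (y : Site d) (a : Fin d × Bool) : Prop := (a.2 = true ∧ 0 < y a.1) ∨ (a.2 = false ∧ y a.1 < 0)

/-- Coordinates of `y - e_a`: unchanged off `a.1`. [folklore] -/
theorem sub_stepVec_apply_of_ne (y : Site d) (a : Fin d × Bool) {j : Fin d} (hj : j ≠ a.1) :
    (y - stepVec a) j = y j := by
  obtain ⟨k, b⟩ := a
  cases b <;> simp [stepVec, hj]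

/-- Coordinates of `y - e_a`: at `a.1` it is `y_{a.1} ∓ 1`. [folklore] -/
theorem sub_stepVec_apply_self (y : Site d) (a : Fin d × Bool) :
    (y - stepVec a) a.1 = if a.2 then y a.1 - 1 else y a.1 + 1 := by
  obtain ⟨k, b⟩ := a
  cases b <;> simp [stepVec]

/-- The absolute profile of `y - e_a` is that of `y` updated at `a.1`. [folklore] -/
theorem absProfile_sub_stepVec (y : Site d) (a : Fin d × Bool) :
    absProfile (y - stepVec a) =
      Function.update (absProfile y) a.1 ((if a.2 then y a.1 - 1 else y a.1 + 1).natAbs) := by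
  funext j
  by_cases hj : j = a.1
  · subst hj
    rw [Function.update_self, absProfile, sub_stepVec_apply_self]
  · rw [Function.update_of_ne hj, absProfile, absProfile, sub_stepVec_apply_of_ne y a hj]

/-- `Σ_j (update f k v) j + f k = Σ_j f j + v`. [folklore] -/
theorem sum_update_add (f : Fin d → ℕ) (k : Fin d) (v : ℕ) :
    ∑ j, Function.update f k v j + f k = ∑ j, f j + v := by
  classical
  rw [← add_sum_erase univ (fun j => Function.update f k v j) (mem_univ k),
    ← add_sum_erase univ f (mem_univ k), Function.update_self,
    sum_congr rfl (fun j hj => Function.update_of_ne (ne_of_mem_erase hj) v f)]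
  ring

/-- A toward step lowers the norm by one and decrements the profile at its coordinate. [folklore] -/
theorem toward_spec (y : Site d) (a : Fin d × Bool) (h : Toward y a) :
    l1Norm (y - stepVec a) + 1 = l1Norm y ∧ 0 < absProfile y a.1 ∧
      absProfile (y - stepVec a) = Function.update (absProfile y) a.1 (absProfile y a.1 - 1) := by
  have hval : (if a.2 then y a.1 - 1 else y a.1 + 1).natAbs = absProfile y a.1 - 1 ∧ 0 < absProfile y a.1 := by
    obtain ⟨k, b⟩ := a
    unfold Toward absProfile at *
    cases b
    · simp at h ⊢
      omega
    · simp at h ⊢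
      omega
  have hprof : absProfile (y - stepVec a) = Function.update (absProfile y) a.1 (absProfile y a.1 - 1) := by
    rw [absProfile_sub_stepVec, hval.1]
  refine ⟨?_, hval.2, hprof⟩
  have hs := sum_update_add (absProfile y) a.1 (absProfile y a.1 - 1)
  rw [l1Norm_eq_sum_absProfile, l1Norm_eq_sum_absProfile, hprof]
  have := hval.2
  omega

/-- A non-toward step raises the norm by one. [folklore] -/
theorem l1Norm_sub_stepVec_of_not_toward (y : Site d) (a : Fin d × Bool) (h : ¬ Toward y a) :
    l1Norm (y - stepVec a) = l1Norm y + 1 := by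
  have hval : (if a.2 then y a.1 - 1 else y a.1 + 1).natAbs = absProfile y a.1 + 1 := by
    obtain ⟨k, b⟩ := a
    unfold Toward absProfile at *
    cases b
    · simp at h ⊢
      omega
    · simp at h ⊢
      omega
  have hprof : absProfile (y - stepVec a) = Function.update (absProfile y) a.1 (absProfile y a.1 + 1) := by
    rw [absProfile_sub_stepVec, hval]
  have hs := sum_update_add (absProfile y) a.1 (absProfile y a.1 + 1)
  rw [l1Norm_eq_sum_absProfile, l1Norm_eq_sum_absProfile, hprof]
  omega

/-- **Geodesic walks through the recursion**: if `‖y‖₁ = n` and every site of the avoidance set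
has norm `> n`, then `sawCount d n y A = n!/∏ᵢ |yᵢ|!`. [folklore] -/
theorem sawCount_eq_multinomial (n : ℕ) :
    ∀ (y : Site d) (A : Finset (Site d)), l1Norm y = n → (∀ z ∈ A, n < l1Norm z) →
      sawCount d n y A = Nat.multinomial univ (absProfile y) := by
  classical
  induction n with
  | zero =>
    intro y A hy hA
    have hy0 : y = 0 := (l1Norm_eq_zero_iff y).1 hy
    have hyA : y ∉ A := fun h => by have := hA y h; omega
    rw [sawCount_zero_of_not_mem hyA, if_pos hy0]
    subst hy0
    simp [Nat.multinomial, absProfile]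
  | succ n ih =>
    intro y A hy hA
    have hyA : y ∉ A := fun h => by have := hA y h; omega
    rw [sawCount_succ_of_not_mem n hyA, ← sum_filter_add_sum_filter_not univ (Toward y)]
    have haway : ∑ a ∈ univ.filter (fun a => ¬ Toward y a), sawCount d n (y - stepVec a) (insert y A) = 0 := by
      refine sum_eq_zero fun a ha => sawCount_eq_zero_of_lt n _ _ ?_
      rw [l1Norm_sub_stepVec_of_not_toward y a (mem_filter.1 ha).2]
      omega
    have htow : ∀ a ∈ univ.filter (Toward y), sawCount d n (y - stepVec a) (insert y A) =
        Nat.multinomial univ (Function.update (absProfile y) a.1 (absProfile y a.1 - 1)) := by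
      intro a ha
      obtain ⟨hl1, -, hprof⟩ := toward_spec y a (mem_filter.1 ha).2
      rw [ih (y - stepVec a) (insert y A) (by omega) ?_, hprof]
      intro z hz
      rcases mem_insert.1 hz with rfl | hz
      · omega
      · have := hA z hz; omega
    rw [haway, add_zero, sum_congr rfl htow]
    have hpos : 0 < ∑ i, absProfile y i := by rw [← l1Norm_eq_sum_absProfile, hy]; omega
    rw [← sum_multinomial_update_pred (absProfile y) hpos]
    refine sum_nbij' (fun a => a.1) (fun i => (i, decide (0 < y i))) ?_ ?_ ?_ ?_ ?_
    · intro a ha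
      exact mem_filter.2 ⟨mem_univ _, (toward_spec y a (mem_filter.1 ha).2).2.1⟩
    · intro i hi
      have hi' : 0 < absProfile y i := (mem_filter.1 hi).2
      have hne : y i ≠ 0 := Int.natAbs_pos.1 hi'
      refine mem_filter.2 ⟨mem_univ _, ?_⟩
      by_cases hlt : 0 < y i
      · exact Or.inl ⟨by simp [hlt], hlt⟩
      · exact Or.inr ⟨by simp [hlt], show y i < 0 by omega⟩
    · intro a ha
      have h := (mem_filter.1 ha).2
      obtain ⟨k, b⟩ := a
      rcases h with ⟨hb, hy⟩ | ⟨hb, hy⟩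
      · simp only at hb hy ⊢; subst hb; simp [hy]
      · simp only at hb hy ⊢; subst hb; simp [not_lt.2 hy.le]
    · intro i _; rfl
    · intro a _; rfl

/-- **`c_n(x) = n!/∏ᵢ |xᵢ|!` for `‖x‖₁ = n`**, for every `d`: the self-avoiding walks `0 → x` with
exactly `‖x‖₁` steps are the `n!/∏ᵢ|xᵢ|!` arrangements of their steps. [folklore] -/
theorem card_sawWordsTo_of_l1Norm_eq (n : ℕ) (y : Site d) (hy : l1Norm y = n) :
    (sawWordsTo d n y).card = Nat.multinomial univ (absProfile y) := by
  rw [card_sawWordsTo_eq_sawCount]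
  exact sawCount_eq_multinomial n y ∅ hy (by simp)


/-! ### Evaluation on the class representatives `siteOfList l d` -/

/-- The profile of `siteOfList l d` is `|l_i|` (zero beyond the list). [folklore] -/
theorem absProfile_siteOfList (l : List ℤ) (i : Fin d) : absProfile (siteOfList l d) i = (l.getD i 0).natAbs := rfl

/-- A sum over `Fin d` of a sequence vanishing from `s ≤ d` on is the sum over `range s`. [folklore] -/
theorem sum_fin_eq_sum_range_of_eq_zero (h : ℕ → ℕ) {s : ℕ} (hs : s ≤ d) (hz : ∀ i, s ≤ i → h i = 0) :
    ∑ i : Fin d, h i = ∑ i ∈ range s, h i := by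
  rw [Fin.sum_univ_eq_sum_range, ← sum_range_add_sum_Ico _ hs,
    sum_eq_zero (s := Ico s d) (fun i hi => hz i (mem_Ico.1 hi).1), add_zero]

/-- A product over `Fin d` of a sequence equal to one from `s ≤ d` on is the product over `range s`. [folklore] -/
theorem prod_fin_eq_prod_range_of_eq_one (h : ℕ → ℕ) {s : ℕ} (hs : s ≤ d) (hz : ∀ i, s ≤ i → h i = 1) :
    ∏ i : Fin d, h i = ∏ i ∈ range s, h i := by
  rw [Fin.prod_univ_eq_prod_range, ← prod_range_mul_prod_Ico _ hs,
    prod_eq_one (s := Ico s d) (fun i hi => hz i (mem_Ico.1 hi).1), mul_one]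

/-- `‖siteOfList l d‖₁ = Σ_{i < |l|} |l_i|` for `|l| ≤ d`. [folklore] -/
theorem l1Norm_siteOfList_eq_sum_range (l : List ℤ) (hd : l.length ≤ d) :
    l1Norm (siteOfList l d) = ∑ i ∈ range l.length, (l.getD i 0).natAbs := by
  rw [l1Norm_eq_sum_absProfile]
  exact sum_fin_eq_sum_range_of_eq_zero (fun i => (l.getD i 0).natAbs) hd
    (fun i hi => by simp [List.getD_eq_getElem?_getD, List.getElem?_eq_none_iff.2 hi])

/-- The multinomial coefficient of the profile of `siteOfList l d`, `|l| ≤ d`, in closed form. [folklore] -/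
theorem multinomial_absProfile_siteOfList (l : List ℤ) (hd : l.length ≤ d) :
    Nat.multinomial univ (absProfile (siteOfList l d)) =
      (∑ i ∈ range l.length, (l.getD i 0).natAbs)! / ∏ i ∈ range l.length, ((l.getD i 0).natAbs)! := by
  rw [Nat.multinomial, ← l1Norm_eq_sum_absProfile, l1Norm_siteOfList_eq_sum_range l hd]
  congr 1
  exact prod_fin_eq_prod_range_of_eq_one (fun i => ((l.getD i 0).natAbs)!) hd
    (fun i hi => by simp [List.getD_eq_getElem?_getD, List.getElem?_eq_none_iff.2 hi])

/-- **`c_n(siteOfList l d)` for geodesic classes**, every `d ≥ |l|`: if `Σ |l_i| = n` then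
`#sawWordsTo d n (siteOfList l d) = n! / ∏ |l_i|!`. [folklore] -/
theorem card_sawWordsTo_siteOfList_geodesic (l : List ℤ) (n d : ℕ) (hd : l.length ≤ d)
    (hn : ∑ i ∈ range l.length, (l.getD i 0).natAbs = n) :
    (sawWordsTo d n (siteOfList l d)).card = n ! / ∏ i ∈ range l.length, ((l.getD i 0).natAbs)! := by
  rw [card_sawWordsTo_of_l1Norm_eq n _ (by rw [l1Norm_siteOfList_eq_sum_range l hd, hn]),
    multinomial_absProfile_siteOfList l hd, hn]

/-- `c_10(x) = 10!/2! = 1814400` for `x ∼ (1,1,1,1,1,1,1,1,2)` on `ℤ^d`, every `d ≥ 9`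
(`SRW.nb` §3: `nrSAW[10,d,{1,1,1,1,1,1,1,1,2}] = 1814400`). [folklore] -/
theorem card_sawWordsTo_n10_x111111112 (d : ℕ) (hd : 9 ≤ d) :
    (sawWordsTo d 10 (siteOfList [1, 1, 1, 1, 1, 1, 1, 1, 2] d)).card = 1814400 :=
  (card_sawWordsTo_siteOfList_geodesic [1, 1, 1, 1, 1, 1, 1, 1, 2] 10 d hd (by decide)).trans (by decide)

/-- `c_10(x) = 10! = 3628800` for `x ∼ (1,1,1,1,1,1,1,1,1,1)` on `ℤ^d`, every `d ≥ 10`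
(`SRW.nb` §3: `nrSAW[10,d,{1,…,1}] = 3628800`). [folklore] -/
theorem card_sawWordsTo_n10_x1111111111 (d : ℕ) (hd : 10 ≤ d) :
    (sawWordsTo d 10 (siteOfList [1, 1, 1, 1, 1, 1, 1, 1, 1, 1] d)).card = 3628800 :=
  (card_sawWordsTo_siteOfList_geodesic [1, 1, 1, 1, 1, 1, 1, 1, 1, 1] 10 d hd (by decide)).trans (by decide)

/-- `c_n(n·e₁) = 1`: the straight line is the only `n`-step self-avoiding walk to `(n,0,…,0)`,
every `n` and every `d ≥ 1`. [folklore] -/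
theorem card_sawWordsTo_line (n d : ℕ) (hd : 1 ≤ d) :
    (sawWordsTo d n (siteOfList [(n : ℤ)] d)).card = 1 := by
  rw [card_sawWordsTo_siteOfList_geodesic [(n : ℤ)] n d hd (by simp)]
  simp [Nat.div_self (Nat.factorial_pos n)]

end Literature.Probability.FitznerVanDerHofstad2017
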